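import Mathlib
import HarnessLib
import Literature.MathematicalPhysics.StatisticalMechanics.GaussianFormChange
import Literature.MathematicalPhysics.StatisticalMechanics.InitialHamiltonianRepresentation
import Literature.MathematicalPhysics.StatisticalMechanics.TuningParameterSegment
import Summits.HubbardSuperconductivity.HubbardSuperconductivity.Theorems.ComplexGFFStiffnessHypACumulantFlowStart

/-!
# Crux `HypACumulant`, line `gnv` — the partition function as the start of the TUNED flow:
# `pertZ n 𝒦 = c · ∫ (e^{−ℋ} ∘_0 K̂_0(𝒦, ℋ))(Λ, φ) μ^{(q(ℋ))}(dφ)`, `c ≠ 0` ([ABKM19] (4.5)–(4.8), (12.8))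

Route `route-HubbardSuperconductivity-ComplexGFFStiffness`, crux item stmt-HubbardSuperconductivity-19154,
research stub `stub_gnvOfFrd : TorusFRD 4 → GNV` (R-list entry R6a).  `…HypACumulantFlowStart` wrote
`pertZ n 𝒦` as `Z₀ ∫ (e^{−0} ∘ K_0)(Λ) dμ^{(0)}` with `μ^{(0)} = tailMeasure 𝒞_{𝟙} N N`.  Chapter 12 of
[ABKM19] runs the renormalisation group from a RELEVANT SEED `ℋ ∈ M_0 ⊗ ℂ` with REAL quadratic part
(the `ι`-symmetric class, `…HypACumulantIotaTuning`): the Gaussian is then `μ^{(q)}`, `q = q(ℋ)`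
(`GradientRG.hamQuadForm`), i.e. the step measures of the finite-range decomposition of `∇*(𝟙+q)∇`
(`TorusFRD` at `A = 𝟙 + q`), and the scale-`0` coordinate is `K̂_0(𝒦, ℋ) = e^{−ℋ}𝒦` (`initKH`).
This file proves the corresponding representation of the model's partition function:

* `integral_prod_eq_formChange_pcirc` (general `d`) — for the total kernels `𝒞 = Σ_k𝒞_{𝟙,k}`,
  `𝒞' = Σ_k𝒞_{𝟙+q(ℋ),k}`: `∫ ∏_x(1+𝒦(∇φ(x))) dμ_𝒞 = κ • (e^{λ|Λ|} ∫ (e^{−ℋ}∘K̂_0(𝒦,ℋ))(Λ) dμ_{𝒞'})`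
  (`GaussianFormChange.integral_stepMeasure_eq_formChange` + `exp_quadForm_smul_prod_eq`);
* **`pertZ_eq_mul_integral_flowStart_q`** (`d = 4`) — `pertZ n 𝒦 = c · ∫ (e^{−ℋ}∘_0K̂_0(𝒦,ℋ))(Λ,φ)
  (tailMeasure 𝒞_{𝟙+q(ℋ)} N N)(dφ)` with `c = Z₀ · κ_{𝟙,𝟙+q(ℋ)} · e^{λ|Λ|}`, and
  **`flowStartConst_ne_zero`**: `c ≠ 0`; packaged as **`exists_pertZ_eq_mul_integral_flowStart_q`**.

So `GNV` is reduced to `∫ F_N dμ_{N+1} ≠ 0` for the TUNED flow of `exists_tuned_initial_iota_of_torusFRD`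
(R6c: `integral_flow_eq` along the trajectory, `x_N = 0`, `∫|K_N| ≤ ½`).  All proved; no `sorry`.

## References
* S. Adams, S. Buchholz, R. Kotecký, S. Müller, arXiv:1910.13564, Ch. 4.2 (4.5)–(4.12), Ch. 12.1 (12.8)
  [AdamsBuchholzKoteckyMuller2019].
-/

noncomputable section

-- `Summit.<Summit>.<Problem>`: single-conjunct summit, the duplicate component is mandated (D-0017).
set_option linter.dupNamespace false

namespace Summit.HubbardSuperconductivity.HubbardSuperconductivity.Theorems.ComplexGFF

open scoped BigOperators Classical
open MeasureTheory Finset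
open Literature.MathematicalPhysics.StatisticalMechanics.ComplexGradientGFF4 (D S)
open Literature.MathematicalPhysics.StatisticalMechanics.GradientRG
open Literature.MathematicalPhysics.StatisticalMechanics.GradientFRD (ellOp conv IsElliptic)
open Literature.MathematicalPhysics.StatisticalMechanics.TorusPolymer (pcirc)
open Literature.Barriers.CriticalPhenomena.LongRangePhi4 (fieldGaussian)

/-! ## General dimension: the product integrand under `μ_𝒞` versus the seeded circle product under `μ_{𝒞'}` -/

section General

variable {d M : ℕ} [NeZero M]

/-- **`∫ ∏_x(1+𝒦(∇φ(x))) dμ_𝒞 = κ • (e^{λ|Λ|} ∫ (e^{−ℋ} ∘ K̂_0(𝒦,ℋ))(Λ) dμ_{𝒞'})`** for total kernels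
`𝒞` (of `∇*∇`) and `𝒞'` (of `∇*(𝟙+q(ℋ))∇`) with zero sum, `circulant ⪰ 0` and the inversion clause on
zero-average fields, a relevant Hamiltonian `ℋ` with real quadratic coefficients, and continuous `𝒦`. -/
theorem integral_prod_eq_formChange_pcirc {𝒞 𝒞' : (Fin d → ZMod M) → ℝ} {H : RelevantHamiltonian ℂ d}
    (hq : ∀ p : quadIndex d, ((H (Sum.inr (Sum.inr p))).re : ℂ) = H (Sum.inr (Sum.inr p)))
    (h0 : ∑ x, 𝒞 x = 0) (hC : (Matrix.circulant 𝒞).PosSemidef)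
    (hinv : ∀ φ : (Fin d → ZMod M) → ℝ, ∑ x, φ x = 0 →
      ellOp (1 : Matrix (Fin d) (Fin d) ℝ) (conv 𝒞 φ) = φ)
    (h0' : ∑ x, 𝒞' x = 0) (hC' : (Matrix.circulant 𝒞').PosSemidef)
    (hinv' : ∀ φ : (Fin d → ZMod M) → ℝ, ∑ x, φ x = 0 →
      ellOp ((1 : Matrix (Fin d) (Fin d) ℝ) + hamQuadForm H) (conv 𝒞' φ) = φ)
    {𝒦 : (Fin d → ℝ) → ℂ} (h𝒦 : Continuous 𝒦) :
    ∫ φ, (∏ x : Fin d → ZMod M, (1 + 𝒦 (gradAt x φ))) ∂(stepMeasure 𝒞) =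
      formChangeConst (M := M) (1 : Matrix (Fin d) (Fin d) ℝ) (1 + hamQuadForm H) •
        (Complex.exp ((Fintype.card (Fin d → ZMod M) : ℂ) * H (Sum.inl ())) *
          ∫ φ, pcirc 1 (fun V => expNegH H V φ) (fun U => initKH 𝒦 H U φ) univ ∂(stepMeasure 𝒞')) := by
  have hsymm : ((1 : Matrix (Fin d) (Fin d) ℝ) + hamQuadForm H).IsSymm :=
    Matrix.isSymm_one.add (hamQuadForm_isSymm H)
  -- the product integrand is continuous and shift invariant
  have hga : ∀ x : Fin d → ZMod M, Continuous fun φ : (Fin d → ZMod M) → ℝ => gradAt x φ :=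
    fun x => (LinearMap.toContinuousLinearMap (gradAt x)).continuous
  have hcont : Continuous fun φ : (Fin d → ZMod M) → ℝ => ∏ x : Fin d → ZMod M, (1 + 𝒦 (gradAt x φ)) :=
    continuous_finsetProd _ fun x _ => continuous_const.add (h𝒦.comp (hga x))
  have hshift : ∀ (φ : (Fin d → ZMod M) → ℝ) (a : ℝ),
      (∏ x : Fin d → ZMod M, (1 + 𝒦 (gradAt x (φ + fun _ => a)))) = ∏ x : Fin d → ZMod M, (1 + 𝒦 (gradAt x φ)) := by
    intro φ a
    refine Finset.prod_congr rfl fun x _ => ?_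
    congr 2
    ext i
    simp [gradAt, Literature.MathematicalPhysics.StatisticalMechanics.GradientFRD.fwdDiff]
  rw [integral_stepMeasure_eq_formChange Matrix.isSymm_one hsymm h0 hC hinv h0' hC' hinv'
    hcont.stronglyMeasurable hshift, add_sub_cancel_left]
  congr 1
  simp_rw [exp_quadForm_smul_prod_eq 𝒦 hq]
  exact integral_const_mul _ _

end General

/-! ## `d = 4`: the partition function of the model -/

variable {n : ℕ} [NeZero n]

/-- **`pertZ` as the start of the TUNED flow** ([ABKM19] (4.5)–(4.8) with the seed (12.8)).  Let
`𝒞₁ = (𝒞_{𝟙,k})_k` and `𝒞q = (𝒞_{𝟙+q(ℋ),k})_k`, `k = 1,…,N+1`, be kernel families on `(ℤ/n)^4` with zero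
sums, even, positive on mean-zero fields, whose sums invert `∇*∇`, resp. `∇*(𝟙+q(ℋ))∇`, on mean-zero
fields (clauses (o), (i), (ii) of `GradientFRD.TorusFRD` at `A = 𝟙` and `A = 𝟙 + q(ℋ)`), `ℋ` a relevant
Hamiltonian with real quadratic coefficients, `𝒦` continuous.  Then
`pertZ n 𝒦 = c · ∫ (e^{−ℋ} ∘_0 K̂_0(𝒦, ℋ))(Λ, φ) (tailMeasure 𝒞q N N)(dφ)`,
`c = Z₀ · κ_{𝟙,𝟙+q(ℋ)} · e^{λ|Λ|}` (`Z₀ = ∫e^{−S_0}`, `κ = formChangeConst`, `λ` the constant coefficient) —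
the left-hand side of `integral_flow_eq` for the flow started at `(ℋ, K̂_0(𝒦,ℋ))` with the Gaussian
`μ^{(q(ℋ))}`. -/
theorem pertZ_eq_mul_integral_flowStart_q {N : ℕ} {𝒞₁ 𝒞q : ℕ → (Fin 4 → ZMod n) → ℝ}
    {H : RelevantHamiltonian ℂ 4}
    (hq : ∀ p : quadIndex 4, ((H (Sum.inr (Sum.inr p))).re : ℂ) = H (Sum.inr (Sum.inr p)))
    (h0₁ : ∀ k ∈ Finset.Icc 1 (N + 1), ∑ x, 𝒞₁ k x = 0)
    (heven₁ : ∀ k ∈ Finset.Icc 1 (N + 1), ∀ x, 𝒞₁ k (-x) = 𝒞₁ k x)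
    (hpos₁ : ∀ k ∈ Finset.Icc 1 (N + 1), ∀ φ : (Fin 4 → ZMod n) → ℝ, ∑ x, φ x = 0 →
      0 ≤ ∑ x, ∑ y, φ x * 𝒞₁ k (x - y) * φ y)
    (hinv₁ : ∀ φ : (Fin 4 → ZMod n) → ℝ, ∑ x, φ x = 0 →
      ellOp (1 : Matrix (Fin 4) (Fin 4) ℝ) (conv (fun x => ∑ k ∈ Finset.Icc 1 (N + 1), 𝒞₁ k x) φ) = φ)
    (h0q : ∀ k ∈ Finset.Icc 1 (N + 1), ∑ x, 𝒞q k x = 0)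
    (hevenq : ∀ k ∈ Finset.Icc 1 (N + 1), ∀ x, 𝒞q k (-x) = 𝒞q k x)
    (hposq : ∀ k ∈ Finset.Icc 1 (N + 1), ∀ φ : (Fin 4 → ZMod n) → ℝ, ∑ x, φ x = 0 →
      0 ≤ ∑ x, ∑ y, φ x * 𝒞q k (x - y) * φ y)
    (hinvq : ∀ φ : (Fin 4 → ZMod n) → ℝ, ∑ x, φ x = 0 →
      ellOp ((1 : Matrix (Fin 4) (Fin 4) ℝ) + hamQuadForm H)
        (conv (fun x => ∑ k ∈ Finset.Icc 1 (N + 1), 𝒞q k x) φ) = φ)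
    {K : (Fin 4 → ℝ) → ℂ} (hK : Continuous K) :
    pertZ n K =
      (((∫ φ : (Fin 4 → ZMod n) → ℝ, Real.exp (-(S 0 φ)) : ℝ) : ℂ) *
        ((formChangeConst (M := n) (1 : Matrix (Fin 4) (Fin 4) ℝ) (1 + hamQuadForm H) : ℝ) : ℂ) *
          Complex.exp ((Fintype.card (Fin 4 → ZMod n) : ℂ) * H (Sum.inl ()))) *
        ∫ φ, pcirc 1 (fun V => expNegH H V φ) (fun U => initKH K H U φ) Finset.univ ∂(tailMeasure 𝒞q N N) := by
  rw [pertZ_eq_mul_integral_greenMat hK]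
  -- the total kernels
  set 𝒞 : (Fin 4 → ZMod n) → ℝ := fun x => ∑ k ∈ Finset.Icc 1 (N + 1), 𝒞₁ k x with h𝒞def
  set 𝒞' : (Fin 4 → ZMod n) → ℝ := fun x => ∑ k ∈ Finset.Icc 1 (N + 1), 𝒞q k x with h𝒞'def
  have hG : greenMat n = Matrix.circulant 𝒞 := by
    rw [← sum_circulant_eq_greenMat_of_frd 𝒞₁ h0₁ hinv₁]
    ext i j; simp [Matrix.sum_apply, Matrix.circulant_apply, h𝒞def]
  have hC : (Matrix.circulant 𝒞).PosSemidef := posSemidef_circulant_sum h0₁ heven₁ hpos₁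
  have hC' : (Matrix.circulant 𝒞').PosSemidef := posSemidef_circulant_sum h0q hevenq hposq
  have h0 : ∑ x, 𝒞 x = 0 := by
    simp only [h𝒞def]
    rw [Finset.sum_comm]
    exact Finset.sum_eq_zero fun k hk => h0₁ k hk
  have h0' : ∑ x, 𝒞' x = 0 := by
    simp only [h𝒞'def]
    rw [Finset.sum_comm]
    exact Finset.sum_eq_zero fun k hk => h0q k hk
  -- the integrand as a function of the scalar field
  set F : ((Fin 4 → ZMod n) → ℝ) → ℂ := fun ψ => ∏ x : Fin 4 → ZMod n, (1 + K (gradAt x ψ)) with hF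
  have hprod : ∀ φ : (Fin 4 → ZMod n) → Fin 1 → ℝ,
      (∏ x : Fin 4 → ZMod n, (1 + K (fun i => D (squeeze φ) i x))) = F (fun x => φ x 0) := by
    intro φ
    rfl
  have hga : ∀ x : Fin 4 → ZMod n, Continuous fun φ : (Fin 4 → ZMod n) → ℝ => gradAt x φ :=
    fun x => (LinearMap.toContinuousLinearMap (gradAt x)).continuous
  have hcontF : Continuous F :=
    continuous_finsetProd _ fun x _ => continuous_const.add (hK.comp (hga x))
  simp_rw [hprod]
  rw [hG, ← integral_stepMeasure_eq_fieldGaussian hC hcontF.aestronglyMeasurable, hF,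
    integral_prod_eq_formChange_pcirc hq h0 hC hinv₁ h0' hC' hinvq hK, Complex.real_smul]
  -- `stepMeasure 𝒞' = tailMeasure 𝒞q N N`
  have htail : tailMeasure 𝒞q N N = stepMeasure 𝒞' := by
    rw [tailMeasure, tailKernel_self 𝒞q N N le_rfl, show N + 1 - N = 1 by omega]
  rw [htail]
  ring

/-- **The scalar `c = Z₀ · κ_{𝟙,𝟙+q(ℋ)} · e^{λ|Λ|}` of `pertZ_eq_mul_integral_flowStart_q` is non-zero**:
`Z₀ > 0` (`integral_exp_neg_S_pos`), `κ > 0` (`formChangeConst_pos`), `e^{λ|Λ|} ≠ 0`. -/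
theorem flowStartConst_ne_zero {N : ℕ} {𝒞₁ 𝒞q : ℕ → (Fin 4 → ZMod n) → ℝ} {H : RelevantHamiltonian ℂ 4}
    (h0₁ : ∀ k ∈ Finset.Icc 1 (N + 1), ∑ x, 𝒞₁ k x = 0)
    (heven₁ : ∀ k ∈ Finset.Icc 1 (N + 1), ∀ x, 𝒞₁ k (-x) = 𝒞₁ k x)
    (hpos₁ : ∀ k ∈ Finset.Icc 1 (N + 1), ∀ φ : (Fin 4 → ZMod n) → ℝ, ∑ x, φ x = 0 →
      0 ≤ ∑ x, ∑ y, φ x * 𝒞₁ k (x - y) * φ y)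
    (hinv₁ : ∀ φ : (Fin 4 → ZMod n) → ℝ, ∑ x, φ x = 0 →
      ellOp (1 : Matrix (Fin 4) (Fin 4) ℝ) (conv (fun x => ∑ k ∈ Finset.Icc 1 (N + 1), 𝒞₁ k x) φ) = φ)
    (h0q : ∀ k ∈ Finset.Icc 1 (N + 1), ∑ x, 𝒞q k x = 0)
    (hevenq : ∀ k ∈ Finset.Icc 1 (N + 1), ∀ x, 𝒞q k (-x) = 𝒞q k x)
    (hposq : ∀ k ∈ Finset.Icc 1 (N + 1), ∀ φ : (Fin 4 → ZMod n) → ℝ, ∑ x, φ x = 0 →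
      0 ≤ ∑ x, ∑ y, φ x * 𝒞q k (x - y) * φ y)
    (hinvq : ∀ φ : (Fin 4 → ZMod n) → ℝ, ∑ x, φ x = 0 →
      ellOp ((1 : Matrix (Fin 4) (Fin 4) ℝ) + hamQuadForm H)
        (conv (fun x => ∑ k ∈ Finset.Icc 1 (N + 1), 𝒞q k x) φ) = φ) :
    (((∫ φ : (Fin 4 → ZMod n) → ℝ, Real.exp (-(S 0 φ)) : ℝ) : ℂ) *
        ((formChangeConst (M := n) (1 : Matrix (Fin 4) (Fin 4) ℝ) (1 + hamQuadForm H) : ℝ) : ℂ) *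
          Complex.exp ((Fintype.card (Fin 4 → ZMod n) : ℂ) * H (Sum.inl ()))) ≠ 0 := by
  have hsymm : ((1 : Matrix (Fin 4) (Fin 4) ℝ) + hamQuadForm H).IsSymm :=
    Matrix.isSymm_one.add (hamQuadForm_isSymm H)
  have hC := posSemidef_circulant_sum h0₁ heven₁ hpos₁
  have hC' := posSemidef_circulant_sum h0q hevenq hposq
  have h0 : ∑ x, (fun x => ∑ k ∈ Finset.Icc 1 (N + 1), 𝒞₁ k x) x = 0 := by
    simp only
    rw [Finset.sum_comm]
    exact Finset.sum_eq_zero fun k hk => h0₁ k hk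
  have h0' : ∑ x, (fun x => ∑ k ∈ Finset.Icc 1 (N + 1), 𝒞q k x) x = 0 := by
    simp only
    rw [Finset.sum_comm]
    exact Finset.sum_eq_zero fun k hk => h0q k hk
  have hκ := formChangeConst_pos Matrix.isSymm_one hsymm h0 hC hinv₁ h0' hC' hinvq
  have hZ := integral_exp_neg_S_pos (n := n)
  refine mul_ne_zero (mul_ne_zero ?_ ?_) (Complex.exp_ne_zero _)
  · exact_mod_cast hZ.ne'
  · exact_mod_cast hκ.ne'

/-- **R6a packaged**: `∃ c ≠ 0, pertZ n 𝒦 = c · ∫ (e^{−ℋ} ∘_0 K̂_0(𝒦,ℋ))(Λ) d(tailMeasure 𝒞q N N)` under the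
hypotheses of `pertZ_eq_mul_integral_flowStart_q`. -/
theorem exists_pertZ_eq_mul_integral_flowStart_q {N : ℕ} {𝒞₁ 𝒞q : ℕ → (Fin 4 → ZMod n) → ℝ}
    {H : RelevantHamiltonian ℂ 4}
    (hq : ∀ p : quadIndex 4, ((H (Sum.inr (Sum.inr p))).re : ℂ) = H (Sum.inr (Sum.inr p)))
    (h0₁ : ∀ k ∈ Finset.Icc 1 (N + 1), ∑ x, 𝒞₁ k x = 0)
    (heven₁ : ∀ k ∈ Finset.Icc 1 (N + 1), ∀ x, 𝒞₁ k (-x) = 𝒞₁ k x)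
    (hpos₁ : ∀ k ∈ Finset.Icc 1 (N + 1), ∀ φ : (Fin 4 → ZMod n) → ℝ, ∑ x, φ x = 0 →
      0 ≤ ∑ x, ∑ y, φ x * 𝒞₁ k (x - y) * φ y)
    (hinv₁ : ∀ φ : (Fin 4 → ZMod n) → ℝ, ∑ x, φ x = 0 →
      ellOp (1 : Matrix (Fin 4) (Fin 4) ℝ) (conv (fun x => ∑ k ∈ Finset.Icc 1 (N + 1), 𝒞₁ k x) φ) = φ)
    (h0q : ∀ k ∈ Finset.Icc 1 (N + 1), ∑ x, 𝒞q k x = 0)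
    (hevenq : ∀ k ∈ Finset.Icc 1 (N + 1), ∀ x, 𝒞q k (-x) = 𝒞q k x)
    (hposq : ∀ k ∈ Finset.Icc 1 (N + 1), ∀ φ : (Fin 4 → ZMod n) → ℝ, ∑ x, φ x = 0 →
      0 ≤ ∑ x, ∑ y, φ x * 𝒞q k (x - y) * φ y)
    (hinvq : ∀ φ : (Fin 4 → ZMod n) → ℝ, ∑ x, φ x = 0 →
      ellOp ((1 : Matrix (Fin 4) (Fin 4) ℝ) + hamQuadForm H)
        (conv (fun x => ∑ k ∈ Finset.Icc 1 (N + 1), 𝒞q k x) φ) = φ)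
    {K : (Fin 4 → ℝ) → ℂ} (hK : Continuous K) :
    ∃ c : ℂ, c ≠ 0 ∧ pertZ n K =
      c * ∫ φ, pcirc 1 (fun V => expNegH H V φ) (fun U => initKH K H U φ) Finset.univ ∂(tailMeasure 𝒞q N N) :=
  ⟨_, flowStartConst_ne_zero h0₁ heven₁ hpos₁ hinv₁ h0q hevenq hposq hinvq,
    pertZ_eq_mul_integral_flowStart_q hq h0₁ heven₁ hpos₁ hinv₁ h0q hevenq hposq hinvq hK⟩

/-- **`𝟙 + q(ℋ)` is elliptic** (`∈ 𝓛(½, 2)`) as soon as `Σ_{ij}|q(ℋ)_{ij}| ≤ ½` — the form in which the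
finite-range decomposition `TorusFRD 4` is invoked at `A = 𝟙 + q(ℋ)` (so that its clauses (o)–(ii)
supply the hypotheses `h0q`, `hevenq`, `hposq`, `hinvq` above). -/
theorem isElliptic_one_add_hamQuadForm {H : RelevantHamiltonian ℂ 4}
    (hT : ∑ i, ∑ j, |hamQuadForm H i j| ≤ 1 / 2) :
    IsElliptic (1 / 2 : ℝ) 2 ((1 : Matrix (Fin 4) (Fin 4) ℝ) + hamQuadForm H) :=
  isElliptic_one_add_of_entrySum_le (hamQuadForm_isSymm H) hT

/-- On the `ι`-symmetric class the quadratic coefficients are real: the hypothesis `hq` of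
`pertZ_eq_mul_integral_flowStart_q` from `IsIotaHam`. -/
theorem ofReal_re_quad_of_isIotaHam {H : RelevantHamiltonian ℂ 4} (hH : IsIotaHam H) (p : quadIndex 4) :
    ((H (Sum.inr (Sum.inr p))).re : ℂ) = H (Sum.inr (Sum.inr p)) := by
  have h := hH.2.2 p
  exact Complex.conj_eq_iff_re.1 h

end Summit.HubbardSuperconductivity.HubbardSuperconductivity.Theorems.ComplexGFF

end
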